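import Literature.NumberTheory.EllipticCurves.Greenberg1999.ControlLocalKernelsLayerFixedPointProofs
import Literature.NumberTheory.EllipticCurves.TwoTorsionCardProofs
import Literature.NumberTheory.EllipticCurves.SelmerRestrictionCorank
import HarnessLib

/-!
# The type-free ADDITIVE lever at `p = 2`: no `K_v`-rational `2`-torsion at an additive `v ∤ 2` ⟹
# Greenberg's local tower kernel `𝒦_{v,n}[2^∞]` is TRIVIAL at every layer of every `ℤ₂`-extension

`Proofs` file (theorems only: **no definition, no named fact, nothing asserted**), sequel of
`ControlLocalKernelsLayerFixedPointProofs` (`#𝒦_{v,n}[p^∞] ≤ #(B')^{g}`). Source: R. Greenberg, *Iwasawa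
theory for elliptic curves*, LNM 1716 (1999), §3, proof of Lemma 3.3, held copy
`book:coatesnd-arithmetic-theory-elliptic-curves` PDF p. 88: "`|ker(r_v)| = c_v^{(p)}` when E has
additive reduction at v"; and J. H. Silverman, *AEC*, III.§2 / Ex. 3.7 (the nonzero `2`-torsion points
are the `(x, y)` with `x` a root of `4x³ + b₂x² + 2b₄x + b₆`), VIII.§1 (Galois action on torsion).

* `index_localSubgroup_layerSubgroup_dvd` — `[Γ_{K_v} : H_{v,n}] ∣ pⁿ`.
* `eq_zero_of_two_nsmul_eq_zero_of_fixed_of_index_dvd` — a point of order dividing `2` of `E(K̄_v)`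
  fixed by a subgroup of `2`-power index of `Γ_{K_v}` is `O` when `E(K_v)` has no point of order `2`
  (its orbit has `2`-power size among the three points of order `2`: size `1` is a rational point,
  size `2` gives the rational point `x + y`).
* **`finite_and_natCard_localTowerKerPrimary_le_one_of_additive_of_twoTorsion`** (any number field
  `K`, ANY `ℤ₂`-extension, every layer): at an ADDITIVE place `v ∤ 2` at which `E(K_v)` has no point of
  order `2`, `#𝒦_{v,n}[2^∞] ≤ 1`. This re-derives the zero-bit local constant of Kodaira types II, IV,
  IV*, II* WITHOUT component groups and is NEW for type I₀* with Tamagawa number `c_v = 1` (Frobenius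
  a `3`-cycle on `E[2]`, never rational in a `2`-tower); Greenberg's count `|ker(r_{v_n})| =
  c_{v_n}^{(2)}` reads `1` at every layer there.

HONEST FRAMING (cell `bsd-2adic`, seat `bsd-2adic-tower-1` GEN 12, HUMAN RULING D-0074 (T1)): tool
theorems for the TOWER doors of route ByReductionTypeAtTwo (items stmt-BirchSwinnertonDyer-19271 /
19922: the per-place local constant `C_v` at an odd additive prime); close no item by themselves; BSD
is not proved by any of this.

## References

* [GreenbergLNM1716] R. Greenberg, LNM 1716 (1999), §3 Lemma 3.3 (PDF pp. 86–88).
* [SilvermanAEC2009] J. H. Silverman, *AEC*, 2nd ed. (2009), III.§2 and Ex. 3.7, VIII.§1, Thm. VII.6.1.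

## Design

No definitions, no named facts; `noncomputable section`; `open scoped Classical NNReal`; one universe
`u`; the main theorem reproduces the setting of the tree's
`finite_and_natCard_localTowerKerPrimary_le_four_of_additive`. Axioms: `propext`, `Classical.choice`,
`Quot.sound`.
-/

noncomputable section

open scoped Classical NNReal
open NumberField IsDedekindDomain Field

universe u

namespace Literature.NumberTheory.EllipticCurves.Greenberg1999

open Literature.NumberTheory.EllipticCurves Literature.NumberTheory.GaloisRepresentations
  Literature.NumberTheory.EllipticCurves.FormalGroupChart Literature.NumberTheory.EllipticCurves.ResKernel
  _root_.Field _root_.IsDedekindDomain.HeightOneSpectrum _root_.WeierstrassCurve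

/-! ## §2 The `p = 2` lever at an additive `v ∤ 2`: no `K_v`-rational `2`-torsion ⟹ `𝒦_{v,n}[2^∞] = 0` -/

section Two

variable {K : Type u} [Field K] [NumberField K] (W : WeierstrassCurve K) {v : HeightOneSpectrum (𝓞 K)}

omit [NumberField K] in
/-- **`[Γ_{K_v} : H_{v,n}]` divides `pⁿ`** (`H_{v,n} = (Γ_{K_v} → Γ_K)⁻¹(Gal(K̄/K_n))`, `Γ_{K_v}/H_{v,n} ↪
Γ_K/Gal(K̄/K_n)`, of order `pⁿ`): the layer subgroup is normal of index `pⁿ`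
(`ZpExtension.index_layerSubgroup`) and `index_localSubgroupOfEmb_dvd`. Greenberg, LNM 1716, §3 p. 86
(the local degrees `[(F_n)_{v_n} : F_v]` are powers of `p`). [cite: GreenbergLNM1716, §3 p. 86] -/
theorem index_localSubgroup_layerSubgroup_dvd {p : ℕ} [Fact p.Prime] (κ : ZpExtension K p)
    (E : Type u) [Field E] [Algebra K E] (n : ℕ) :
    (localSubgroup (κ.layerSubgroup n) E).index ∣ p ^ n := by
  rw [← κ.index_layerSubgroup n]
  exact index_localSubgroupOfEmb_dvd (κ.layerSubgroup n) (closureEmb (K := K) E)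

/-- **A `2`-torsion point of `E(K̄_v)` fixed by a subgroup of `2`-power index of `Γ_{K_v}` is `O`, if
`E(K_v)` has no point of order `2`.** For `H ≤ Γ_{K_v}` with `[Γ_{K_v} : H] ∣ 2ⁿ` and `c ∈ E(K̄_v)`,
`2c = O`, fixed by `H`: the `Γ_{K_v}`-orbit of `c` has `[Γ_{K_v} : Stab(c)] ∣ 2ⁿ` elements, all of order
dividing `2`; if `c ≠ O` they are among the three points of order `2` (`#E(K̄_v)[2] ≤ 4`, tree
`ncard_setOf_add_self_eq_zero_le`), so the orbit is `{c}` — `c` is `Γ_{K_v}`-fixed, excluded — or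
`{x, y}` with `x ≠ y`, and then `x + y ≠ O` is a `Γ_{K_v}`-fixed point of order `2` (every `σ` permutes
`{x, y}`), excluded. (The `2`-division cubic of Silverman, *AEC*, III.§2 / Ex. 3.7: a root in an
extension of `2`-power degree forces a root in `K_v`.) [cite: SilvermanAEC2009, III.§2 and Ex. 3.7; VIII.§1] -/
theorem eq_zero_of_two_nsmul_eq_zero_of_fixed_of_index_dvd [W.IsElliptic]
    (h2 : ∀ P : localPoints W (v.adicCompletion K),
      (∀ σ : absoluteGaloisGroup (v.adicCompletion K), σ • P = P) → 2 • P = 0 → P = 0)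
    {H : Subgroup (absoluteGaloisGroup (v.adicCompletion K))} {n : ℕ} (hH : H.index ∣ 2 ^ n)
    {c : localPoints W (v.adicCompletion K)} (hc : 2 • c = 0) (hfix : ∀ σ ∈ H, σ • c = c) :
    c = 0 := by
  classical
  let G : Type u := absoluteGaloisGroup (v.adicCompletion K)
  let Pt : Type u := localPoints W (v.adicCompletion K)
  by_contra hc0
  -- the stabilizer contains `H`, so the orbit has `2`-power size
  have hHS : H ≤ MulAction.stabilizer G c := fun σ hσ ↦ by
    rw [MulAction.mem_stabilizer_iff]; exact hfix σ hσ
  have hidx : (MulAction.stabilizer G c).index ∣ 2 ^ n :=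
    (Subgroup.index_dvd_of_le hHS).trans hH
  rw [MulAction.index_stabilizer] at hidx
  obtain ⟨t, -, hcard⟩ := (Nat.dvd_prime_pow Nat.prime_two).mp hidx
  set O : Set Pt := MulAction.orbit G c with hO
  -- `2 ≠ 0` in `K̄_v`
  have h2ne : (2 : AlgebraicClosure (v.adicCompletion K)) ≠ 0 := by
    haveI : CharZero (v.adicCompletion K) :=
      charZero_of_injective_algebraMap (algebraMap K (v.adicCompletion K)).injective
    haveI : CharZero (AlgebraicClosure (v.adicCompletion K)) :=
      charZero_of_injective_algebraMap (algebraMap (v.adicCompletion K) _).injective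
    exact two_ne_zero
  -- the orbit consists of nonzero points killed by `2`
  set T : Set Pt := {P : Pt | P + P = 0} with hT
  have hTfin : T.Finite := by
    haveI hf : Finite (AddSubgroup.torsionBy
        (W.baseChange (AlgebraicClosure (v.adicCompletion K))).toAffine.Point (2 : ℤ)) :=
      WeierstrassCurve.finite_torsionBy_baseChange W (AlgebraicClosure (v.adicCompletion K)) two_ne_zero
    let ι : T → AddSubgroup.torsionBy
        (W.baseChange (AlgebraicClosure (v.adicCompletion K))).toAffine.Point (2 : ℤ) := fun P ↦
      ⟨(P.1 : (W.baseChange (AlgebraicClosure (v.adicCompletion K))).toAffine.Point),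
        (Submodule.mem_torsionBy_iff (R := ℤ) _ _).mpr (by rw [two_zsmul]; exact P.2)⟩
    have hι : Function.Injective ι := fun a b h ↦ Subtype.ext (congrArg Subtype.val h :)
    haveI : Finite T := Finite.of_injective ι hι
    exact Set.toFinite T
  have hT4 : T.ncard ≤ 4 :=
    WeierstrassCurve.ncard_setOf_add_self_eq_zero_le (W.baseChange (AlgebraicClosure (v.adicCompletion K))) h2ne
  have h0T : (0 : Pt) ∈ T := by simp [hT]
  have hOsub : O ⊆ T \ {0} := by
    intro P hP
    obtain ⟨σ, rfl⟩ := MulAction.mem_orbit_iff.mp hP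
    refine ⟨?_, ?_⟩
    · show σ • c + σ • c = 0
      rw [← smul_add, ← two_nsmul, hc, smul_zero]
    · intro h
      apply hc0
      have h' : σ • c = 0 := h
      have : c = σ⁻¹ • σ • c := (inv_smul_smul σ c).symm
      rw [this, h', smul_zero]
  have hO3 : O.ncard ≤ 3 := by
    have h1 : O.ncard ≤ (T \ {0}).ncard := Set.ncard_le_ncard hOsub (hTfin.subset Set.sdiff_subset)
    rw [Set.ncard_sdiff_singleton_of_mem h0T] at h1
    omega
  rw [hcard] at hO3
  have ht1 : t ≤ 1 := by
    by_contra h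
    have : 2 ^ 2 ≤ 2 ^ t := Nat.pow_le_pow_right (by norm_num) (by omega)
    omega
  have hmemO : ∀ (σ : G) {x : Pt}, x ∈ O → σ • x ∈ O := by
    intro σ x hx
    obtain ⟨τ, rfl⟩ := MulAction.mem_orbit_iff.mp hx
    rw [smul_smul]
    exact MulAction.mem_orbit c (σ * τ)
  interval_cases t
  · -- orbit `= {c}`: `c` is rational
    rw [pow_zero, Set.ncard_eq_one] at hcard
    obtain ⟨a, ha⟩ := hcard
    have hca : c = a := by
      have : c ∈ O := MulAction.mem_orbit_self c
      rw [ha] at this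
      exact this
    refine hc0 (h2 c (fun σ ↦ ?_) hc)
    have : σ • c ∈ O := MulAction.mem_orbit c σ
    rw [ha] at this
    rw [Set.mem_singleton_iff.mp this, ← hca]
  · -- orbit `= {x, y}`: `x + y` is a rational point of order `2`
    rw [pow_one, Set.ncard_eq_two] at hcard
    obtain ⟨x, y, hxy, hOeq⟩ := hcard
    have hx : x ∈ O := by rw [hOeq]; exact Set.mem_insert _ _
    have hy : y ∈ O := by rw [hOeq]; exact Set.mem_insert_of_mem _ rfl
    have hx2 : x + x = 0 := (hOsub hx).1
    have hy2 : y + y = 0 := (hOsub hy).1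
    have hperm : ∀ σ : G, σ • x + σ • y = x + y := by
      intro σ
      have hσx := hmemO σ hx
      have hσy := hmemO σ hy
      rw [hOeq] at hσx hσy
      have hne : σ • x ≠ σ • y := fun h ↦ hxy (MulAction.injective σ h)
      rcases hσx with h1 | h1 <;> rcases hσy with h3 | h3
      · exact absurd (h1.trans (Set.mem_singleton_iff.mp h3).symm) hne
      · rw [h1, Set.mem_singleton_iff.mp h3]
      · rw [Set.mem_singleton_iff.mp h1, h3, add_comm]
      · exact absurd ((Set.mem_singleton_iff.mp h1).trans (Set.mem_singleton_iff.mp h3).symm) hne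
    have hsum_ne : x + y ≠ 0 := by
      intro h
      have hyx : y = -x := eq_neg_of_add_eq_zero_right h
      have hxx : -x = x := (neg_eq_of_add_eq_zero_right hx2)
      exact hxy (by rw [hyx, hxx])
    have hsum2 : 2 • (x + y) = 0 := by
      rw [two_nsmul, add_add_add_comm, hx2, hy2, add_zero]
    exact hsum_ne (h2 (x + y) (fun σ ↦ by rw [smul_add, hperm σ]) hsum2)

set_option maxHeartbeats 1600000 in
/-- **The type-free additive lever at `p = 2`: at an ADDITIVE place `v ∤ 2` at which `E(K_v)` has no
point of order `2`, `𝒦_{v,n}[2^∞]` is TRIVIAL at every layer `n` of ANY `ℤ₂`-extension.** Here "no point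
of order `2` over `K_v`" is stated on the `Γ_{K_v}`-module `E(K̄_v)`: every `Γ_{K_v}`-fixed `P` with
`2P = O` is `O` (for `K = ℚ`: the `2`-division cubic `4x³ + b₂x² + 2b₄x + b₆` has no root in `ℚ_ℓ`).
Proof: `#𝒦_{v,n}[2^∞] ≤ #{b ∈ B' : g • b = b}` (§1, `B' = E(K̄_v)^{I}[2^∞]` finite at an additive place by
Kodaira–Néron over `K_v^nr`, tree `finite_and_natCard_inertiaFixed_primary_le_four_of_hasAdditiveReduction`),
and a `g`-fixed `b ∈ B'` is fixed by the open subgroup generated by `I` and `g`, i.e. by `H_{v,n}`, of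
index dividing `2ⁿ`; if `b ≠ O`, a suitable multiple `2ᵏb` has order `2`, contradicting
`eq_zero_of_two_nsmul_eq_zero_of_fixed_of_index_dvd`. Covers Kodaira types II, IV, IV*, II* (no
`K_v`-rational `2`-torsion ever) and type I₀* with Tamagawa number `c_v = 1`; Greenberg's count
`|ker(r_{v_n})| = c_{v_n}^{(2)}` (LNM 1716 p. 88) then reads `1` at every layer.
[cite: GreenbergLNM1716, §3 Lemma 3.3 (proof, PDF pp. 87–88)] [cite: SilvermanAEC2009, Thm. VII.6.1; III.§2 Ex. 3.7] -/
theorem finite_and_natCard_localTowerKerPrimary_le_one_of_additive_of_twoTorsion [W.IsElliptic]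
    (κ : ZpExtension K 2) (h2v : ((2 : ℕ) : 𝓞 K) ∉ v.asIdeal) (hadd : W.HasAdditiveReductionAt v)
    (h2 : ∀ P : localPoints W (v.adicCompletion K),
      (∀ σ : absoluteGaloisGroup (v.adicCompletion K), σ • P = P) → 2 • P = 0 → P = 0)
    (n : ℕ) :
    Finite (W.localTowerKerPrimary κ (v.adicCompletion K) n) ∧
      Nat.card (W.localTowerKerPrimary κ (v.adicCompletion K) n) ≤ 1 := by
  classical
  let G : Type u := Field.absoluteGaloisGroup (v.adicCompletion K)
  let Pt : Type u := localPoints W (v.adicCompletion K)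
  -- the prime `𝔐`, a Frobenius, the generator `g = F^M`
  obtain ⟨𝔐, h𝔐⟩ := v.localPrimesAbove_nonempty
  haveI hInormal : (𝔐.inertia G).Normal := inertia_normal_of_mem_localPrimesAbove v h𝔐
  obtain ⟨F, hF⟩ := exists_isArithFrobAt_localAbsIntegers (v := v) h𝔐
  obtain ⟨M, -, hgHn, hgen⟩ := exists_frobenius_pow_generate_localSubgroup κ h2v h𝔐 hF n
  obtain ⟨w, hw⟩ := v.exists_spectralValuation
  -- the minimal model and the equivariant transport: `B'` is finite
  set X := W.localMinimalModel v with hXdef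
  haveI : X.IsElliptic := W.isElliptic_localMinimalModel v
  haveI : X.HasAdditiveReduction (v.adicCompletionIntegers K) := hadd
  obtain ⟨hfinS, -⟩ :=
    X.finite_and_natCard_inertiaFixed_primary_le_four_of_hasAdditiveReduction w hw h𝔐 Nat.prime_two h2v
  obtain ⟨C, hC⟩ := W.exists_variableChange_smul_eq_localMinimalModel v
  obtain ⟨Φ, hΦ⟩ := W.exists_addEquiv_localPoints_of_smul_eq v hC
  set Mi : AddSubgroup Pt := FixedPoints.addSubgroup (𝔐.inertia G) Pt with hMi
  set B : AddSubgroup Mi := AddCommGroup.primaryComponent Mi 2 with hB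
  let j : B → {P : (X.baseChange (AlgebraicClosure (v.adicCompletion K))).toAffine.Point //
        (∀ σ ∈ 𝔐.inertia (absoluteGaloisGroup (v.adicCompletion K)),
          Affine.Point.map ((absoluteGaloisGroup.toAlgEquiv _ σ :
              AlgebraicClosure (v.adicCompletion K) ≃ₐ[v.adicCompletion K]
                AlgebraicClosure (v.adicCompletion K)) :
              AlgebraicClosure (v.adicCompletion K) →ₐ[v.adicCompletion K]
                AlgebraicClosure (v.adicCompletion K)) P = P) ∧
        ∃ k : ℕ, 2 ^ k • P = 0} := fun b ↦
    ⟨Φ ((b : Mi) : Pt), fun σ hσ ↦ by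
        rw [← hΦ]
        exact congrArg Φ ((b : Mi).2 ⟨σ, hσ⟩), by
        obtain ⟨k, hk⟩ := (AddCommGroup.mem_primaryComponent).mp b.2
        refine ⟨k, ?_⟩
        rw [← map_nsmul, ← AddSubgroupClass.coe_nsmul, hk]
        exact map_zero Φ⟩
  have hj : Function.Injective j := by
    intro a b hab
    have h := congrArg Subtype.val hab
    exact Subtype.ext (Subtype.ext (Φ.injective h))
  haveI hfinB : Finite B := Finite.of_injective j hj
  -- every point fixed by `I` and `g` and killed by a power of `2` is `O`
  have hHn : (localSubgroup (κ.layerSubgroup n) (v.adicCompletion K)).index ∣ 2 ^ n :=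
    index_localSubgroup_layerSubgroup_dvd κ (v.adicCompletion K) n
  have hstab : ∀ P : Pt, (∀ τ ∈ 𝔐.inertia G, τ • P = P) → F ^ M • P = P →
      ∀ σ ∈ localSubgroup (κ.layerSubgroup n) (v.adicCompletion K), σ • P = P := by
    intro P hI hg σ hσ
    have hopen : IsOpen ((MulAction.stabilizer G P : Subgroup G) : Set G) := by
      change IsOpen ((fun σ : G ↦ σ • P) ⁻¹' {P})
      exact (continuous_smul_localPoints W (v.adicCompletion K) P).isOpen_preimage _
        (isOpen_discrete _)
    have hle := hgen (MulAction.stabilizer G P) hopen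
      (fun τ hτ ↦ by rw [MulAction.mem_stabilizer_iff]; exact hI τ hτ)
      (by rw [MulAction.mem_stabilizer_iff]; exact hg)
    exact MulAction.mem_stabilizer_iff.mp (hle hσ)
  have hzero : ∀ (k : ℕ) (P : Pt), (∀ τ ∈ 𝔐.inertia G, τ • P = P) → F ^ M • P = P →
      2 ^ k • P = 0 → P = 0 := by
    intro k
    induction k with
    | zero => intro P _ _ hk; rwa [pow_zero, one_smul] at hk
    | succ k ih =>
      intro P hI hg hk
      -- `Q = 2ᵏ P` has order dividing `2` and is fixed by `I` and `g`
      have hQ2 : 2 • (2 ^ k • P) = 0 := by rw [smul_smul, ← pow_succ', hk]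
      have hQI : ∀ τ ∈ 𝔐.inertia G, τ • (2 ^ k • P) = 2 ^ k • P := fun τ hτ ↦ by
        rw [smul_comm, hI τ hτ]
      have hQg : F ^ M • (2 ^ k • P) = 2 ^ k • P := by rw [smul_comm, hg]
      have hQ0 : 2 ^ k • P = 0 :=
        eq_zero_of_two_nsmul_eq_zero_of_fixed_of_index_dvd W h2 hHn hQ2 (hstab _ hQI hQg)
      exact ih P hI hg hQ0
  -- hence `(B')^{g}` is trivial
  have hN : Nat.card {b : B // F ^ M • (((b : Mi)) : Pt) = ((b : Mi) : Pt)} ≤ 1 := by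
    haveI : Finite {b : B // F ^ M • (((b : Mi)) : Pt) = ((b : Mi) : Pt)} :=
      Finite.of_injective (fun x ↦ x.1) Subtype.val_injective
    refine Finite.card_le_one_iff_subsingleton.mpr ⟨fun a b ↦ ?_⟩
    have hab : ∀ x : {b : B // F ^ M • (((b : Mi)) : Pt) = ((b : Mi) : Pt)}, (x.1 : B) = 0 := by
      intro x
      obtain ⟨k, hk⟩ := (AddCommGroup.mem_primaryComponent).mp x.1.2
      have hk' : 2 ^ k • (((x.1 : B) : Mi) : Pt) = 0 := by
        have h := congrArg (fun z : Mi ↦ (z : Pt)) hk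
        simpa only [AddSubgroupClass.coe_nsmul, ZeroMemClass.coe_zero] using h
      have hI : ∀ τ ∈ 𝔐.inertia G, τ • (((x.1 : B) : Mi) : Pt) = ((x.1 : B) : Mi) :=
        fun τ hτ ↦ ((x.1 : B) : Mi).2 ⟨τ, hτ⟩
      have h0 := hzero k _ hI x.2 hk'
      exact Subtype.ext (Subtype.ext h0)
    exact Subtype.ext ((hab a).trans (hab b).symm)
  exact finite_and_natCard_localTowerKerPrimary_le_of_inertiaPrimary_fixed W κ h2v n h𝔐 hgHn hgen
    (N := 1) hfinB hN

end Two

end Literature.NumberTheory.EllipticCurves.Greenberg1999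

end
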